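import Summits.ResolutionOfSingularities.ResolutionOfSingularities.Theorems.EquisingularLiftEquisingularLiftNatBlowupChartPointInjective
import Literature.AlgebraicGeometry.Resolution.ColonIdealSheafFG
import Literature.AlgebraicGeometry.Resolution.MarkedIdeals
import HarnessLib

/-!
# [OURS · L1 W4.5(b) · EL♮(3)] T-DIRLIFT part D1 — THE DIRECTION CENTRE: a DIRECTION `𝒟` along the in-carrier curve `C = V(I)`
# (`I² ≤ 𝒟 ≤ I`, `𝒟_x = (ℓ) + I_x²` for a frame `I_x = (ℓ, m)`) and its centre `Γ̃ := (τ^*𝒟 : E_C)` on the blow-up `τ` of `C` —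
# stalks on the two charts: `(m, ℓ/m)` on the chart `m` (the section `[ℓ : m] = [0 : 1]`), the unit ideal on the chart `ℓ`

Crux chain w45b (cell `res-hironaka`, slot W4.5(b)), working crux **EL♮** = stmt-ResolutionOfSingularities-20038, child **EL♮(3)** =
stmt-ResolutionOfSingularities-20148, route EquisingularLift, line `sections`; registered stubs `stub_elnat_dirZeroPointResolution` (rung v8 DIR₀)
and `stub_elnat_towerPointResolution` (rung TOWER, Čech-witnessed rounds); supplier object **T-DIRLIFT** (res-L1-w45b-plan-1 CHAIN v7.24 O2
«T-DIRLIFT → stub-2», 2026-08-27T16:16Z; res-type-027 credited for DIRSTEP 2c225bf73b11508a and T-P1VB parts 1–13). HONEST FRAMING: OURS; NOT a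
statement of any manuscript; AI-written, weaker than expert review. No `sorry`; standard axioms. DEF-FREE.
`--supports stmt-ResolutionOfSingularities-20148 --as helper`.

THE CUT (stub-2 STATUS 16:19:12Z). The upstairs half of a DIRECTION STEP is stated in IDEAL-SHEAF currency: a direction along the in-carrier
curve `C = V(I)` of the stage `X` is an ideal sheaf `𝒟` with `I² ≤ 𝒟 ≤ I` and, at the point, `𝒟_x = (ℓ) + I_x²` for a frame `I_x = (ℓ, m)` — i.e.
`𝒟/I² ⊂ I/I²` is a sub-line-bundle of the conormal bundle, the object T-P1VB part 13 (`P1VB.exists_subLineBundle_lift_projectiveLine`, p538935)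
outputs, read through `I ↠ I/I²`. The CENTRE of the direction step on the blow-up `τ : X₁ → X` of `C` is NOT the strict transform of `𝒟`
(which is the unit ideal, `√𝒟 = √I`) but the weight-one CONTROLLED transform `Γ̃ := (τ^*𝒟 : E_C)` (tree `controlledTransform τ I 𝒟 1`,
`MarkedIdeals`): the section `{[ℓ : m] = [0 : 1]}` of the `ℙ¹`-bundle `E_C → C`.

WHAT (namespace `…Cruxes.EquisingularLiftNat.Sections`; ANY blowing up `τ : X₁ → X` along `I`, any schemes):
* `colon_span_pair_mul_eq`, `colon_eq_top_of_mem` — the two ring computations `((g e, g²) : g) = (e, g)` (`g` a non-zero-divisor) and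
  `((g, …) : g) = ⊤`.
* `mem_nonZeroDivisors_of_stalkIdeal_comap_eq_span` — a generator of the exceptional stalk of a blowing up is a non-zero-divisor.
* **`stalkIdeal_directionCentre_of_chart_one`** — at a point `y` over `x` presented on the chart `m` (`= c 1`): `Γ̃_y = (τ♯ m) + (χ (ℓ/m))`,
  and `(E_C)_y = (τ♯ m)`.
* **`stalkIdeal_directionCentre_of_chart_zero`** — at a point presented on the chart `ℓ` (`= c 0`): `Γ̃_y = ⊤` (the section misses the chart).
Parts D2–D4 (regularity / `O`-flatness / exactness of `Γ̃` under the model square) and part B (downstairs `DirStepSec`/`DirStepUnobs` ↦ direction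
+ Čech hypothesis) follow in separate files.

References: Görtz–Wedhorn, *Algebraic Geometry I* (2020), (13.19), Prop. 13.96; The Stacks Project, Tags 0804, 052Q; BGMW 2011 §3.2 (controlled
transform) — through the tree files `MarkedIdeals`, `ColonIdealSheafFG` (`IsBlowup.stalkIdeal_controlledTransform`), p540294.
-/

set_option linter.dupNamespace false -- mandated namespace `Summit.<Summit>.<Problem>` of this single-conjunct summit

noncomputable section

open CategoryTheory CategoryTheory.Limits AlgebraicGeometry TopologicalSpace IsLocalRing
open Literature.AlgebraicGeometry.Resolution
open AlgebraicGeometry.Scheme.IdealSheafData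

namespace Summit.ResolutionOfSingularities.ResolutionOfSingularities.Cruxes.EquisingularLiftNat.Sections

universe u

/-! ## Two ring computations -/

/-- `((g·e) + (g·g) : g) = (e) + (g)` for a non-zero-divisor `g`. [folklore] -/
theorem colon_span_pair_mul_eq {R : Type u} [CommRing R] {g : R} (hg : g ∈ nonZeroDivisors R) (e : R) :
    (Ideal.span {g * e} ⊔ Ideal.span {g * g}).colon (Ideal.span {g}) = Ideal.span {e} ⊔ Ideal.span {g} := by
  apply le_antisymm
  · intro b hb
    rw [Ideal.colon_span, Submodule.mem_colon_singleton] at hb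
    rw [Ideal.mem_span_singleton_sup] at hb ⊢
    obtain ⟨u, z, hz, huz⟩ := hb
    obtain ⟨v, rfl⟩ := Ideal.mem_span_singleton'.mp hz
    refine ⟨u, v * g, Ideal.mem_span_singleton'.mpr ⟨v, rfl⟩, ?_⟩
    -- `g · (u e + v g) = g · b`
    have h : g * (u * e + v * g) = g * b := by
      rw [smul_eq_mul] at huz
      linear_combination huz
    exact (mul_cancel_left_mem_nonZeroDivisors hg).mp h
  · rw [Ideal.colon_span]
    refine sup_le ?_ ?_ <;> rw [Ideal.span_singleton_le_iff_mem, Submodule.mem_colon_singleton, smul_eq_mul]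
    · exact Ideal.mem_sup_left (Ideal.mem_span_singleton'.mpr ⟨1, by ring⟩)
    · exact Ideal.mem_sup_right (Ideal.mem_span_singleton'.mpr ⟨1, by ring⟩)

/-- `(J : g) = ⊤` as soon as `g ∈ J`. [folklore] -/
theorem colon_eq_top_of_mem {R : Type u} [CommRing R] {J : Ideal R} {g : R} (hg : g ∈ J) : J.colon (Ideal.span {g}) = ⊤ := by
  rw [eq_top_iff]
  intro b _
  rw [Ideal.colon_span, Submodule.mem_colon_singleton, smul_eq_mul]
  exact J.mul_mem_left b hg

/-- **A generator of the exceptional stalk of a blowing up is a non-zero-divisor** (the exceptional divisor is effective Cartier).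
[cite: GortzWedhorn2020, Def. 13.90] -/
theorem mem_nonZeroDivisors_of_stalkIdeal_comap_eq_span {X' X : Scheme.{u}} {π : X' ⟶ X} {J : X.IdealSheafData}
    (hπ : IsBlowup π J) (x' : X') {u : X'.presheaf.stalk x'} (hu : stalkIdeal (J.comap π) x' = Ideal.span {u}) :
    u ∈ nonZeroDivisors (X'.presheaf.stalk x') := by
  obtain ⟨t, ht0, ht⟩ := hπ.isEffectiveCartier.exists_stalkIdeal_eq_span x'
  rw [hu] at ht
  obtain ⟨a, ha⟩ := Ideal.mem_span_singleton'.mp (ht ▸ Ideal.mem_span_singleton_self u : u ∈ Ideal.span {t})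
  obtain ⟨b, hb⟩ := Ideal.mem_span_singleton'.mp (ht.symm ▸ Ideal.mem_span_singleton_self t : t ∈ Ideal.span {u})
  have hab : b * a = 1 := by
    have h0 : (1 - b * a) * t = 0 := by rw [sub_mul, one_mul, mul_assoc, ha, hb, sub_self]
    exact (sub_eq_zero.mp ((mem_nonZeroDivisors_iff_right.mp ht0) _ h0)).symm
  rw [← ha]
  exact mul_mem (IsUnit.mem_nonZeroDivisors (IsUnit.of_mul_eq_one_right b hab)) ht0

/-! ## The direction centre on the two charts -/

section Charts

variable {X₁ X : Scheme.{u}} {τ : X₁ ⟶ X} {I : X.IdealSheafData}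

/-- The total transform of a direction: `(τ^*𝒟)_y = (τ♯ ℓ) + (τ♯ m · τ♯ m)`. [folklore] -/
theorem stalkIdeal_comap_direction (𝒟 : X.IdealSheafData) (y : X₁) {x : X} (hy : τ y = x)
    (c : Fin 2 → X.presheaf.stalk x) (h𝒟 : stalkIdeal 𝒟 x = Ideal.span {c 0} ⊔ Ideal.span {c 1 * c 1}) :
    stalkIdeal (𝒟.comap τ) y =
      Ideal.span {((X.presheaf.stalkCongr (.of_eq hy)).inv ≫ τ.stalkMap y).hom (c 0)} ⊔
        Ideal.span {((X.presheaf.stalkCongr (.of_eq hy)).inv ≫ τ.stalkMap y).hom (c 1) *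
          ((X.presheaf.stalkCongr (.of_eq hy)).inv ≫ τ.stalkMap y).hom (c 1)} := by
  subst hy
  have hself : ∀ a, ((X.presheaf.stalkCongr (.of_eq (rfl : τ y = τ y))).inv ≫ τ.stalkMap y).hom a =
      (τ.stalkMap y).hom a := fun a => by
    rw [CommRingCat.comp_apply, TopCat.Presheaf.stalkCongr_inv]
    congr 1
    exact stalkSpecializes_self_apply X.presheaf (τ y) _ a
  simp only [hself]
  rw [stalkIdeal_comap_eq_map_stalkMap, h𝒟, Ideal.map_sup, Ideal.map_span, Ideal.map_span, Set.image_singleton,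
    Set.image_singleton, map_mul]

/-- **The direction centre on the chart `m`.** `τ : X₁ → X` a blowing up along `I`, `y ∈ X₁` over `x`, `I_x = (c 0, c 1) = (ℓ, m)`,
`𝒟_x = (ℓ) + (m²)` (`= (ℓ) + I_x²`), and `(𝔔, χ)` a presentation of `𝒪_{X₁,y}` on the chart `m`. Then `(E_C)_y = (τ♯ m)` and the
weight-one controlled transform has stalk `Γ̃_y = (τ^*𝒟 : E_C)_y = (τ♯ m) + (χ (ℓ/m))` — the section point `[ℓ : m] = [0 : 1]` of the fibre.
[cite: StacksProject, Tag 0804; BierstoneGrigorievMilmanWlodarczyk2011, §3.2] -/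
theorem stalkIdeal_directionCentre_of_chart_one (hτ : IsBlowup τ I) (𝒟 : X.IdealSheafData) (y : X₁) {x : X} (hy : τ y = x)
    (c : Fin 2 → X.presheaf.stalk x) (hc : Ideal.span (Set.range c) = stalkIdeal I x)
    (h𝒟 : stalkIdeal 𝒟 x = Ideal.span {c 0} ⊔ Ideal.span {c 1 * c 1})
    (χ : blowupAlgebra (Ideal.span (Set.range c)) (c 1) →+* X₁.presheaf.stalk y)
    (hχ : ∀ a, χ (algebraMap _ _ a) = ((X.presheaf.stalkCongr (.of_eq hy)).inv ≫ τ.stalkMap y).hom a) :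
    stalkIdeal (I.comap τ) y = Ideal.span {((X.presheaf.stalkCongr (.of_eq hy)).inv ≫ τ.stalkMap y).hom (c 1)} ∧
      stalkIdeal (controlledTransform τ I 𝒟 1) y =
        Ideal.span {((X.presheaf.stalkCongr (.of_eq hy)).inv ≫ τ.stalkMap y).hom (c 1)} ⊔
          Ideal.span {χ (blowupAlgebra.frac c 1 0)} := by
  have hE := stalkIdeal_comap_eq_span_of_chartPresentation y hy c hc 1 χ hχ
  refine ⟨hE, ?_⟩
  set g := ((X.presheaf.stalkCongr (.of_eq hy)).inv ≫ τ.stalkMap y).hom (c 1) with hgdef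
  have hgnzd : g ∈ nonZeroDivisors _ := mem_nonZeroDivisors_of_stalkIdeal_comap_eq_span hτ y hE
  -- `τ♯ ℓ = χ(ℓ/m) · g`
  have hℓ : ((X.presheaf.stalkCongr (.of_eq hy)).inv ≫ τ.stalkMap y).hom (c 0) = g * χ (blowupAlgebra.frac c 1 0) := by
    rw [mul_comm]; exact (apply_frac_mul c 1 0 χ _ hχ).symm
  rw [hτ.stalkIdeal_controlledTransform 𝒟 1 y, pow_one, stalkIdeal_comap_direction 𝒟 y hy c h𝒟, hE, hℓ, ← hgdef,
    colon_span_pair_mul_eq hgnzd, sup_comm]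

/-- **The direction centre misses the chart `ℓ`.** Same data with a presentation on the chart `ℓ` (`= c 0`): `Γ̃_y = ⊤`
(`τ^*𝒟 ∋ τ♯ ℓ`, the exceptional generator). [cite: StacksProject, Tag 0804] -/
theorem stalkIdeal_directionCentre_of_chart_zero (hτ : IsBlowup τ I) (𝒟 : X.IdealSheafData) (y : X₁) {x : X} (hy : τ y = x)
    (c : Fin 2 → X.presheaf.stalk x) (hc : Ideal.span (Set.range c) = stalkIdeal I x)
    (h𝒟 : stalkIdeal 𝒟 x = Ideal.span {c 0} ⊔ Ideal.span {c 1 * c 1})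
    (χ : blowupAlgebra (Ideal.span (Set.range c)) (c 0) →+* X₁.presheaf.stalk y)
    (hχ : ∀ a, χ (algebraMap _ _ a) = ((X.presheaf.stalkCongr (.of_eq hy)).inv ≫ τ.stalkMap y).hom a) :
    stalkIdeal (controlledTransform τ I 𝒟 1) y = ⊤ := by
  have hE := stalkIdeal_comap_eq_span_of_chartPresentation y hy c hc 0 χ hχ
  rw [hτ.stalkIdeal_controlledTransform 𝒟 1 y, pow_one, stalkIdeal_comap_direction 𝒟 y hy c h𝒟, hE]
  exact colon_eq_top_of_mem (Ideal.mem_sup_left (Ideal.mem_span_singleton_self _))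

end Charts

end Summit.ResolutionOfSingularities.ResolutionOfSingularities.Cruxes.EquisingularLiftNat.Sections

end
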